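import Mathlib
import Summits.MatrixMultiplication.MatrixMultiplication.Theses.HiddenToeplitzCorners

/-! Sketch for crux idea `two-sided-twisted-cores` (strategist gen-4): the first lemma.  The definitions are copied verbatim from
`Cruxes/HiddenCorners/CertificateDegree.lean` (committed in this session; inlined here so the sketch elaborates before the farm has built it). -/

namespace Summit.MatrixMultiplication.MatrixMultiplication.Cruxes.HiddenCorners.TwoSidedTwistedCores

open scoped BigOperators Matrix

noncomputable def pencil {r N : ℕ} (T : Fin r → Fin r → Matrix (Fin N) (Fin N) ℂ)
    (X : Matrix (Fin r) (Fin r) ℂ) : Matrix (Fin N) (Fin N) ℂ :=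
  ∑ a : Fin r, ∑ b : Fin r, X a b • T a b

def Unital {r N : ℕ} (T : Fin r → Fin r → Matrix (Fin N) (Fin N) ℂ) : Prop := pencil T 1 = 1

noncomputable def chDefect {r N : ℕ} (T : Fin r → Fin r → Matrix (Fin N) (Fin N) ℂ)
    (X : Matrix (Fin r) (Fin r) ℂ) : Matrix (Fin N) (Fin N) ℂ :=
  Polynomial.aeval (pencil T X) X.charpoly

def MC {r N : ℕ} (T : Fin r → Fin r → Matrix (Fin N) (Fin N) ℂ) (f : Fin N → ℂ) : Prop :=
  f ≠ 0 ∧ ∀ X : Matrix (Fin r) (Fin r) ℂ, (chDefect T X).mulVec f = 0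

def vecM {r : ℕ} (M : Matrix (Fin r) (Fin r) ℂ) : Fin r × Fin r → ℂ := fun ab => M ab.1 ab.2

def PowerCompatible {r N : ℕ} (T : Fin r → Fin r → Matrix (Fin N) (Fin N) ℂ) (f : Fin N → ℂ) : Prop :=
  ∃ K : Matrix (Fin N) (Fin r × Fin r) ℂ,
    ∀ (X : Matrix (Fin r) (Fin r) ℂ) (k : ℕ), k < r → ((pencil T X) ^ k).mulVec f = K.mulVec (vecM (X ^ k))

def transposePencil {r N : ℕ} (T : Fin r → Fin r → Matrix (Fin N) (Fin N) ℂ) :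
    Fin r → Fin r → Matrix (Fin N) (Fin N) ℂ := fun a b => (T a b)ᵀ

/-- **First lemma (idea `two-sided-twisted-cores`).**  A unital linear pencil `M_3 → M_9` whose (one-dimensional) space of RIGHT
minimal-degree certificates is not power-compatible (not adjugate-span) and which has NO left minimal-degree certificate — numerically realised
by the (MC)-deformations of the two-sided core `X∘M + Λ[X,M]` (kit j026547 + e4sides2); to be proved by exhibiting a rational instance. -/
theorem twoSidedE4_instance :
    ∃ (T : Fin 3 → Fin 3 → Matrix (Fin 9) (Fin 9) ℂ) (f : Fin 9 → ℂ),
      Unital T ∧ MC T f ∧ ¬ PowerCompatible T f ∧ ∀ g : Fin 9 → ℂ, ¬ MC (transposePencil T) g := by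
  sorry

end Summit.MatrixMultiplication.MatrixMultiplication.Cruxes.HiddenCorners.TwoSidedTwistedCores
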